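import Literature.Analysis.UnboundedOperators.HeatKernel
import HarnessLib

/-!
# Temperate growth of the heat symbol `ξ ↦ exp (-(2π)² t ‖ξ‖²)` (discharge)

Sibling proof file of `HeatKernel.lean` (D-0014: named facts `def X : Prop` are discharged as
`theorem X_holds : X`). It discharges

* `Literature.heatSymbol_hasTemperateGrowth_holds : heatSymbol_hasTemperateGrowth` — on any real inner
  product space `E` (no finite-dimensionality needed) and for every `0 ≤ t`, the Fourier
  multiplier `Literature.heatSymbol t = fun ξ => exp (-(2π)² t ‖ξ‖²)` of `e^{tΔ}` has temperate growth
  (`Function.HasTemperateGrowth`), so that it acts on `𝓢(E)` and `𝓢'(E)`.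

This is the Gaussian analogue of the rapid decay of the Poisson multiplier `e^{-2π|ξ|y}` used in
Stein, *Singular Integrals*, Ch. III §2.1, formula (12), to define the Poisson integral of an `L^p`
function on the Fourier side; for the Gauss–Weierstrass kernel the multiplier is
`e^{-4π²t|ξ|²}` (Mathlib's Fourier normalisation), a bounded smooth function all of whose
derivatives grow at most polynomially.

## Proof architecture (as formalised)

`heatSymbol t = Real.exp ∘ f` definitionally, with `f ξ = -(2π)² t ‖ξ‖²`.

1. `f` has temperate growth: a constant multiple of `ξ ↦ ‖ξ‖²`, which is temperate on a real inner
   product space (`Function.hasTemperateGrowth_norm_sq`, via `fun_prop`).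
2. For `0 ≤ t` the range of `f` lies in `(-∞, 0] ⊆ Set.Iio 1`, an open set (so
   `iteratedFDerivWithin = iteratedFDeriv` there and it has unique differentiability).
3. On `Set.Iio 1` every iterated derivative of `Real.exp` is `Real.exp` itself
   (`Real.iter_deriv_exp`), hence bounded in norm by `exp 1`: the outer function satisfies the
   growth hypothesis of `Function.HasTemperateGrowth.comp'` with exponent `k = 0`.
4. `Function.HasTemperateGrowth.comp'` (composition with an outer function that is smooth with
   temperate bounds only on a set containing the range of the inner one) concludes.

## Sources

* E. M. Stein, *Singular Integrals and Differentiability Properties of Functions*, Princeton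
  (1970), Ch. III §2 (Poisson and Gauss–Weierstrass integrals as Fourier multipliers; §2.1 (12)).
-/

open scoped Real

noncomputable section

namespace Literature.Analysis.UnboundedOperators

variable {E : Type*} [NormedAddCommGroup E] [InnerProductSpace ℝ E]

/-- **Discharge of `heatSymbol_hasTemperateGrowth`.** For `0 ≤ t` the multiplier
`ξ ↦ exp (-(2π)² t ‖ξ‖²)` has temperate growth on any real inner product space (no
finite-dimensionality needed). Proof: `heatSymbol t = Real.exp ∘ f` with
`f ξ = -(2π)² t ‖ξ‖²`; `f` has temperate growth (`Function.hasTemperateGrowth_norm_sq` times a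
constant), its range lies in the open half-line `Set.Iio 1`, and on that half-line every iterated
derivative of `exp` is `exp` itself, hence bounded by `exp 1`; Mathlib's
`Function.HasTemperateGrowth.comp'` (outer function temperate only on the range of the inner one)
concludes. This is the Gaussian analogue of the rapid decay of the Poisson multiplier
`e^{-2π|t|y}` used in Stein, *Singular Integrals*, Ch. III §2.1, (12).
[cite: SteinSingularIntegrals1970, Ch. III §2] -/
theorem heatSymbol_hasTemperateGrowth_holds : heatSymbol_hasTemperateGrowth (E := E) := by
  intro t _ht
  have hf : Function.HasTemperateGrowth (fun ξ : E => -(2 * Real.pi) ^ 2 * t * ‖ξ‖ ^ 2) := by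
    fun_prop
  have heq : heatSymbol (E := E) t =
      Real.exp ∘ fun ξ : E => -(2 * Real.pi) ^ 2 * t * ‖ξ‖ ^ 2 := rfl
  rw [heq]
  refine hf.comp' (t := Set.Iio 1) ?_ isOpen_Iio.uniqueDiffOn Real.contDiff_exp.contDiffOn ?_
  · -- the exponent is non-positive, so the range of `f` lies in `Iio 1`
    rintro _ ⟨ξ, rfl⟩
    have : 0 ≤ (2 * Real.pi) ^ 2 * t * ‖ξ‖ ^ 2 := by positivity
    simp only [Set.mem_Iio]
    linarith
  · -- on the open set `Iio 1`, `‖D^n exp x‖ = exp x ≤ exp 1`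
    intro N
    refine ⟨0, Real.exp 1, (Real.exp_pos 1).le, fun n _ x hx => ?_⟩
    rw [iteratedFDerivWithin_of_isOpen n isOpen_Iio hx, norm_iteratedFDeriv_eq_norm_iteratedDeriv,
      iteratedDeriv_eq_iterate, Real.iter_deriv_exp, Real.norm_eq_abs, Real.abs_exp, pow_zero,
      mul_one]
    exact Real.exp_le_exp.mpr (le_of_lt hx)

end Literature.Analysis.UnboundedOperators
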